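import Literature.NumberTheory.EllipticCurves.GeomPointReduction
import Literature.NumberTheory.EllipticCurves.TorsionCardinality
import Literature.NumberTheory.EllipticCurves.TateModule
import Mathlib.AlgebraicGeometry.EllipticCurve.DivisionPolynomial.Degree
import Mathlib.FieldTheory.IsAlgClosed.Basic
import HarnessLib

/-!
# Torsion points are algebraic: `E[n](L) = E[n](K̄)` for every field `L ⊇ K̄`, and `T_p E(K̄) ≅ T_p E(L)`

Topic `Literature/NumberTheory/EllipticCurves` (Silverman AEC III.§7, VII: the torsion of `E` over any algebraically closed field
containing `K̄` is already defined over `K̄`). For an elliptic curve `V` over an ALGEBRAICALLY CLOSED field `K̄`, a field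
homomorphism `g : K̄ → L` and `n` with `n ≠ 0` in `K̄`:

* `exists_eq_of_eval_map_eq_zero` — a root in `L` of a non-zero polynomial over `K̄` is the image of a root in `K̄`;
* **`exists_mapPointHom_eq_of_zsmul_eq_zero`** — every `n`-torsion point of `V(L)` (= `(V.map g)(L)`) is the image under
  `mapPointHom g` of a (unique, `mapPointHom_injective`) `n`-torsion point of `V(K̄)`: its `x`-coordinate is a root of the `n`-division
  polynomial `ΨSq n ≠ 0` (tree `zsmul_some_eq_zero_iff_eval_ΨSq`, Mathlib `ΨSq_ne_zero`), its `y`-coordinate a root of the monic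
  Weierstrass quadratic;
* **`tateModuleMapEquiv`**: for a prime `p` with `(p : K̄) ≠ 0`, `T_p V(K̄) ≃ₗ[ℤ_p] T_p V(L)` along `g` (`TateModule.map` of
  `mapPointHom g`, bijective).

Used with `K̄ = F̄`, `L = ℂ_F` to identify the Tate module of the geometric points with the Tate module of the `ℂ_F`-points
(`PAdicHodge/AinfWeierstrassTateModuleMatching`, matching lane (M) of
`Summits/…/Cruxes/StarredOptimalManinUnitFiveSeven/Lines/kato-lever-hDR-M-matching.md`). BSD / K★: infrastructure; nothing about elliptic
curves over number fields is proved here.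

## References
* J. H. Silverman, *The Arithmetic of Elliptic Curves* (2009), III.§7 (Tate module), Exercise 3.7, VII.§3. [SilvermanAEC2009]
-/

noncomputable section

open scoped Classical
open Polynomial

namespace Literature.NumberTheory.EllipticCurves

section Algebraic

variable {Kb : Type*} [Field Kb] [IsAlgClosed Kb] {L : Type*} [Field L] (g : Kb →+* L)

/-- **A root in `L` of a non-zero polynomial over an algebraically closed field `K̄ ⊆ L` comes from `K̄`** (the polynomial has all its
`natDegree` roots in `K̄`, Mathlib `IsAlgClosed.card_roots_eq_natDegree`, `roots_map_of_injective_of_card_eq_natDegree`).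
[cite: SilvermanAEC2009, III.§7] -/
theorem exists_eq_of_eval_map_eq_zero {q : Kb[X]} (hq : q ≠ 0) {x : L} (hx : (q.map g).eval x = 0) : ∃ a : Kb, g a = x := by
  have hroots := Polynomial.roots_map_of_injective_of_card_eq_natDegree g.injective
    (IsAlgClosed.card_roots_eq_natDegree (p := q))
  have hx' : x ∈ (q.map g).roots := (Polynomial.mem_roots (Polynomial.map_ne_zero hq)).mpr hx
  rw [← hroots, Multiset.mem_map] at hx'
  obtain ⟨a, -, ha⟩ := hx'
  exact ⟨a, ha⟩

variable (V : WeierstrassCurve Kb)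

/-- The Weierstrass quadratic in `y` over the abscissa `a`: `Y² + (a₁a + a₃)Y − (a³ + a₂a² + a₄a + a₆)`. [cite: SilvermanAEC2009, III.§1] -/
def yQuadratic (a : Kb) : Kb[X] :=
  X ^ 2 + C (V.a₁ * a + V.a₃) * X - C (a ^ 3 + V.a₂ * a ^ 2 + V.a₄ * a + V.a₆)

omit [IsAlgClosed Kb] in
/-- The Weierstrass quadratic is monic of degree `2`, hence non-zero. [cite: SilvermanAEC2009, III.§1] -/
theorem yQuadratic_ne_zero (a : Kb) : yQuadratic V a ≠ 0 := by
  have hm : (yQuadratic V a).Monic := by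
    rw [yQuadratic]
    refine Monic.sub_of_left (Monic.add_of_left (monic_X_pow 2) ?_) ?_
    · exact (degree_C_mul_X_le _).trans_lt (by rw [degree_X_pow]; norm_num)
    · exact degree_C_le.trans_lt (by rw [degree_add_eq_left_of_degree_lt] <;> rw [degree_X_pow] <;>
        [norm_num; exact (degree_C_mul_X_le _).trans_lt (by norm_num)])
  exact hm.ne_zero

omit [IsAlgClosed Kb] in
/-- The equation of `V.map g` at `(g a, y)` says `y` is a root of the image of the Weierstrass quadratic over `a`.
[cite: SilvermanAEC2009, III.§1] -/
theorem eval_map_yQuadratic_eq_zero {a : Kb} {y : L} (h : (V.map g).toAffine.Equation (g a) y) :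
    ((yQuadratic V a).map g).eval y = 0 := by
  rw [WeierstrassCurve.Affine.equation_iff] at h
  simp only [WeierstrassCurve.map_a₁, WeierstrassCurve.map_a₂, WeierstrassCurve.map_a₃, WeierstrassCurve.map_a₄,
    WeierstrassCurve.map_a₆] at h
  simp only [yQuadratic, Polynomial.map_sub, Polynomial.map_add, Polynomial.map_pow, Polynomial.map_mul, Polynomial.map_X,
    Polynomial.map_C, map_add, map_mul, map_pow, eval_sub, eval_add, eval_pow, eval_mul, eval_X, eval_C]
  linear_combination h

omit [IsAlgClosed Kb] in
/-- A root of the Weierstrass quadratic over `a` is an ordinate over `a`. [cite: SilvermanAEC2009, III.§1] -/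
theorem equation_of_eval_yQuadratic_eq_zero {a b : Kb} (h : (yQuadratic V a).eval b = 0) : V.toAffine.Equation a b := by
  rw [WeierstrassCurve.Affine.equation_iff]
  simp only [yQuadratic, eval_sub, eval_add, eval_pow, eval_mul, eval_X, eval_C] at h
  linear_combination h

variable [hV : V.IsElliptic]

/-- **Torsion points are algebraic**: an `n`-torsion point of `V(L)` (`n ≠ 0` in `K̄`) is the image under `mapPointHom g` of an
`n`-torsion point of `V(K̄)` — its abscissa is a root of `ΨSq n ≠ 0`, its ordinate a root of the Weierstrass quadratic, both defined
over the algebraically closed `K̄`. [cite: SilvermanAEC2009, III.§7] -/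
theorem exists_mapPointHom_eq_of_zsmul_eq_zero {n : ℤ} (hn : (n : Kb) ≠ 0) {P : (V.map g).toAffine.Point} (hP : n • P = 0) :
    ∃ Q : V.toAffine.Point, V.mapPointHom g Q = P ∧ n • Q = 0 := by
  rcases P with _ | ⟨x, y, h⟩
  · exact ⟨0, map_zero _, smul_zero _⟩
  · -- the abscissa
    have hΨ : ((V.map g).ΨSq n).eval x = 0 := ((V.map g).zsmul_some_eq_zero_iff_eval_ΨSq h n).mp hP
    rw [WeierstrassCurve.map_ΨSq] at hΨ
    obtain ⟨a, rfl⟩ := exists_eq_of_eval_map_eq_zero g (V.ΨSq_ne_zero hn) hΨ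
    -- the ordinate
    obtain ⟨b, rfl⟩ := exists_eq_of_eval_map_eq_zero g (yQuadratic_ne_zero V a) (eval_map_yQuadratic_eq_zero g V h.1)
    have hab : V.toAffine.Equation a b := by
      refine equation_of_eval_yQuadratic_eq_zero V ?_
      have h2 := eval_map_yQuadratic_eq_zero g V h.1
      rwa [Polynomial.eval_map, Polynomial.eval₂_hom, map_eq_zero_iff g g.injective] at h2
    have hns : V.toAffine.Nonsingular a b := (WeierstrassCurve.Affine.equation_iff_nonsingular (W := V)).mp hab
    refine ⟨.some a b hns, ?_, ?_⟩
    · rw [WeierstrassCurve.mapPointHom_some]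
    · apply WeierstrassCurve.mapPointHom_injective V g
      rw [map_zsmul, WeierstrassCurve.mapPointHom_some, map_zero]
      exact hP

omit [IsAlgClosed Kb] hV in
/-- Uniqueness: the `n`-torsion point of `V(K̄)` over a given `n`-torsion point of `V(L)` is unique (`mapPointHom` is injective).
[cite: SilvermanAEC2009, III.§7] -/
theorem mapPointHom_zsmul_eq_zero_iff {n : ℤ} (Q : V.toAffine.Point) : n • V.mapPointHom g Q = 0 ↔ n • Q = 0 := by
  rw [← map_zsmul, ← (V.mapPointHom g).map_zero]
  exact (WeierstrassCurve.mapPointHom_injective V g).eq_iff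

end Algebraic

/-! ## Tate modules: `T_p V(K̄) ≅ T_p V(L)` -/

section Tate

variable {Kb : Type*} [Field Kb] [IsAlgClosed Kb] {L : Type*} [Field L] (g : Kb →+* L) (V : WeierstrassCurve Kb)
  [hV : V.IsElliptic] (p : ℕ) [Fact p.Prime]

/-- **`T_p V(K̄) ≃ₗ[ℤ_p] T_p V(L)`** along a field homomorphism `g : K̄ → L` out of an algebraically closed field in which `p ≠ 0`
(injective by `mapPointHom_injective`, surjective because `p`-power torsion points are algebraic). [cite: SilvermanAEC2009, III.§7] -/
def tateModuleMapEquiv (hp : (p : Kb) ≠ 0) :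
    TateModule V.toAffine.Point p ≃ₗ[ℤ_[p]] TateModule (V.map g).toAffine.Point p :=
  LinearEquiv.ofBijective (TateModule.map p (V.mapPointHom g))
    ⟨by
      intro a b h
      refine TateModule.ext fun n => WeierstrassCurve.mapPointHom_injective V g ?_
      have hn := congrArg (TateModule.proj p n) h
      rwa [TateModule.proj_map, TateModule.proj_map] at hn,
     by
      intro τ
      have hpn : ∀ n : ℕ, (((p ^ n : ℕ) : ℤ) : Kb) ≠ 0 := fun n => by
        rw [Int.cast_natCast, Nat.cast_pow]; exact pow_ne_zero n hp
      -- choose the algebraic preimages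
      have hex : ∀ n : ℕ, ∃ Q : V.toAffine.Point, V.mapPointHom g Q = TateModule.proj p n τ := fun n => by
        obtain ⟨Q, hQ, -⟩ := exists_mapPointHom_eq_of_zsmul_eq_zero g V (n := ((p ^ n : ℕ) : ℤ)) (hpn n)
          (P := TateModule.proj p n τ) (by rw [natCast_zsmul]; exact TateModule.pow_smul_proj n τ)
        exact ⟨Q, hQ⟩
      choose Q hQ using hex
      refine ⟨TateModule.mk Q (fun n => ?_) (fun n => ?_), TateModule.ext fun n => ?_⟩
      · apply WeierstrassCurve.mapPointHom_injective V g
        rw [map_nsmul, hQ, map_zero]; exact TateModule.pow_smul_proj n τ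
      · apply WeierstrassCurve.mapPointHom_injective V g
        rw [map_nsmul, hQ, hQ]; exact TateModule.smul_proj_succ n τ
      · rw [TateModule.proj_map, TateModule.proj_mk, hQ]⟩

/-- Unfolding `tateModuleMapEquiv`: componentwise `mapPointHom g`. [cite: SilvermanAEC2009, III.§7] -/
@[simp] theorem proj_tateModuleMapEquiv (hp : (p : Kb) ≠ 0) (τ : TateModule V.toAffine.Point p) (n : ℕ) :
    TateModule.proj p n (tateModuleMapEquiv g V p hp τ) = V.mapPointHom g (TateModule.proj p n τ) := rfl

end Tate

end Literature.NumberTheory.EllipticCurves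

end
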